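import Summits.CriticalPhenomena.PercolationContinuityZ3.Theorems.PercNearOneGluingNoHeavyLowerTailKnQuestion8CoefficientwiseApex
import Mathlib.Combinatorics.SimpleGraph.Acyclic
import HarnessLib

/-!
# CW-PA(z) when `H − z` is a forest (corollary of THEOREM APEX, prim-lf-2 gen 26)

Support file (`--supports stmt-CriticalPhenomena-4575`, closed), prover `prim-lf-2` (gen 26).  No definitions, no named facts, no sorries; standard axioms.
Memo `prim-lf-2/CW-REDUCTION-gen26.md` §13 (THEOREM APEX⁺).

* `Coefficientwise.eq_root_of_mem_openCluster_both` — if the edges `E₀` are pairwise distinct as unordered pairs and span an acyclic simple graph, then no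
  vertex `y ≠ x` is joined to `x` in both colours by any colouring of `E₀` (the red and the blue path would be two distinct paths of a forest).
* `Coefficientwise.cwpa_of_forest` — hence, by `cwpa_of_noDoublyReachable`, CW-PA(z) holds for every two-terminal multigraph whose edges avoiding `z`
  form a simple forest and none of whose edges joins `x` to `z` — whatever the edges at `z` are (all Θ-graphs, fans, trees with an apex, …).
[cite: KozmaNitzan2024, Questions 8–9 (§5.5 p. 36) (context: first rung of the coefficientwise programme for Question 8)]
-/

namespace Summit.CriticalPhenomena.PercolationContinuityZ3.Theorems

open Finset Literature.Probability.Percolation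

namespace Coefficientwise

variable {ι V : Type*} (ends : ι → Sym2 V)

open Classical in
/-- In a simple forest no vertex other than `x` is reachable from `x` both by red and by blue edges: `E₀` has no two edges with the same ends and its
simple graph is acyclic. [cite: KozmaNitzan2024, §5.5 (context only; folklore)] -/
theorem eq_root_of_mem_openCluster_both {E₀ s₀ : Finset ι} {x y : V} (hs₀ : s₀ ⊆ E₀)
    (hinj : ∀ i ∈ E₀, ∀ j ∈ E₀, ends i = ends j → i = j)
    (hacyc : (openGraph (ends '' (↑E₀ : Set ι))).IsAcyclic)
    (hyr : y ∈ openCluster (ends '' (↑s₀ : Set ι)) x) (hyb : y ∈ openCluster (ends '' (↑(E₀ \ s₀) : Set ι)) x) : y = x := by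
  by_contra hyx
  -- the red and the blue graph are subgraphs of the graph of `E₀`
  have hle : ∀ t : Finset ι, t ⊆ E₀ → openGraph (ends '' (↑t : Set ι)) ≤ openGraph (ends '' (↑E₀ : Set ι)) := by
    intro t ht a b hab
    rw [openGraph_image_adj] at hab ⊢
    obtain ⟨⟨i, hi, he⟩, hne⟩ := hab
    exact ⟨⟨i, ht hi, he⟩, hne⟩
  obtain ⟨p⟩ := (show (openGraph (ends '' (↑s₀ : Set ι))).Reachable x y from hyr)
  obtain ⟨q⟩ := (show (openGraph (ends '' (↑(E₀ \ s₀) : Set ι))).Reachable x y from hyb)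
  -- simple paths in the red / blue graph, mapped into the big graph
  have hp' : ((p.toPath : (openGraph (ends '' (↑s₀ : Set ι))).Walk x y).mapLe (hle s₀ hs₀)).IsPath :=
    (SimpleGraph.Walk.isPath_mapLe (hle s₀ hs₀)).mpr p.toPath.2
  have hq' : ((q.toPath : (openGraph (ends '' (↑(E₀ \ s₀) : Set ι))).Walk x y).mapLe (hle _ Finset.sdiff_subset)).IsPath :=
    (SimpleGraph.Walk.isPath_mapLe (hle _ Finset.sdiff_subset)).mpr q.toPath.2
  have hPQ := hacyc.path_unique ⟨_, hp'⟩ ⟨_, hq'⟩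
  have hwalk : ((p.toPath : (openGraph (ends '' (↑s₀ : Set ι))).Walk x y).mapLe (hle s₀ hs₀)) =
      ((q.toPath : (openGraph (ends '' (↑(E₀ \ s₀) : Set ι))).Walk x y).mapLe (hle _ Finset.sdiff_subset)) :=
    congrArg Subtype.val hPQ
  -- the common path has an edge since `x ≠ y`
  have hlen : ((p.toPath : (openGraph (ends '' (↑s₀ : Set ι))).Walk x y).mapLe (hle s₀ hs₀)).length ≠ 0 :=
    fun h0 => hyx (SimpleGraph.Walk.eq_of_length_eq_zero h0).symm
  obtain ⟨e, he⟩ : ∃ e, e ∈ ((p.toPath : (openGraph (ends '' (↑s₀ : Set ι))).Walk x y).mapLe (hle s₀ hs₀)).edges := by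
    by_contra hno
    apply hlen
    have hnil : ((p.toPath : (openGraph (ends '' (↑s₀ : Set ι))).Walk x y).mapLe (hle s₀ hs₀)).edges = [] :=
      List.eq_nil_iff_forall_not_mem.mpr (fun e he => hno ⟨e, he⟩)
    rw [← SimpleGraph.Walk.length_edges, hnil, List.length_nil]
  -- `e` is a red edge and a blue edge
  have hered : e ∈ (openGraph (ends '' (↑s₀ : Set ι))).edgeSet := by
    have h1 : e ∈ ((p.toPath : (openGraph (ends '' (↑s₀ : Set ι))).Walk x y)).edges := by
      rw [SimpleGraph.Walk.edges_mapLe_eq_edges] at he; exact he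
    exact SimpleGraph.Walk.edges_subset_edgeSet _ h1
  have heblue : e ∈ (openGraph (ends '' (↑(E₀ \ s₀) : Set ι))).edgeSet := by
    have h1 : e ∈ ((q.toPath : (openGraph (ends '' (↑(E₀ \ s₀) : Set ι))).Walk x y)).edges := by
      rw [hwalk, SimpleGraph.Walk.edges_mapLe_eq_edges] at he; exact he
    exact SimpleGraph.Walk.edges_subset_edgeSet _ h1
  have hred' : e ∈ ends '' (↑s₀ : Set ι) := by
    unfold openGraph at hered; rw [SimpleGraph.edgeSet_fromEdgeSet] at hered; exact hered.1
  have hblue' : e ∈ ends '' (↑(E₀ \ s₀) : Set ι) := by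
    unfold openGraph at heblue; rw [SimpleGraph.edgeSet_fromEdgeSet] at heblue; exact heblue.1
  obtain ⟨i, hi, hie⟩ := hred'
  obtain ⟨j, hj, hje⟩ := hblue'
  rw [Finset.mem_coe] at hi hj
  have hij : i = j := hinj i (hs₀ hi) j (Finset.sdiff_subset hj) (hie.trans hje.symm)
  subst hij
  exact (Finset.mem_sdiff.mp hj).2 hi

open Classical in
/-- **COROLLARY (forest).**  Let `E` be a finite edge multiset with terminals `x ≠ z`, no edge joining `x` to `z`, such that the edges avoiding `z` are
pairwise distinct as unordered pairs and span an acyclic simple graph (a forest; loops are irrelevant for connectivity).  Then CW-PA(z) holds for all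
monotone `f, g`, whatever the edges at `z` are.  [cite: KozmaNitzan2024, Questions 8–9 (§5.5 p. 36) (context)] -/
theorem cwpa_of_forest (E : Finset ι) (x z : V) (hxz : z ≠ x) (Vf : Finset V) (hVf : ∀ i ∈ E, ∀ y ∈ ends i, y ∈ Vf)
    (hxzE : ∀ i ∈ E, x ∈ ends i → z ∉ ends i)
    (hinj : ∀ i ∈ E.filter (fun i => z ∉ ends i), ∀ j ∈ E.filter (fun i => z ∉ ends i), ends i = ends j → i = j)
    (hacyc : (openGraph (ends '' (↑(E.filter (fun i => z ∉ ends i)) : Set ι))).IsAcyclic)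
    (f g : Set V → ℝ) (hf : Monotone f) (hg : Monotone g) :
    0 ≤ ∑ s ∈ E.powerset.filter (fun s : Finset ι => z ∉ openCluster (ends '' (↑s : Set ι)) x ∧ z ∉ openCluster (ends '' (↑(E \ s) : Set ι)) x),
      (f (openCluster (ends '' (↑s : Set ι)) x) - f (openCluster (ends '' (↑(E \ s) : Set ι)) x)) *
        (g (openCluster (ends '' (↑s : Set ι)) x) - g (openCluster (ends '' (↑(E \ s) : Set ι)) x)) :=
  cwpa_of_noDoublyReachable ends E x z hxz Vf hVf hxzE
    (fun _ hs₀ _ hyr hyb => eq_root_of_mem_openCluster_both ends hs₀ hinj hacyc hyr hyb) f g hf hg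

end Coefficientwise

end Summit.CriticalPhenomena.PercolationContinuityZ3.Theorems
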